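import Literature.NumberTheory.Rogawski1990.FinExplicitTransferFactorDeepValueInert    -- ★ `sqrt_prod_norm_mul`, `finTau_mul_finWeylRatio_eq_rankOne_mul_rankOne`
import Literature.NumberTheory.Rogawski1990.FinExplicitTransferFactorLeviStratum       -- ★ `endoEmbLocal_eq_glDiagonal_of_fst_eq`, `eval_finCharpolyTwo_eq_of_endoEmbLocal_eq`
import Literature.NumberTheory.Rogawski1990.FinExplicitTransferFactor                  -- ★ `finWeylRatio`, `finCharpolyTwo`, `finGammaTwo`
import HarnessLib

/-!
# F0 · P3c · line LH6 «StCharTS» — road (D) «DEEP-FL», brick (c₅)(ii) «WEYL-LC»: `D_{G/H,v}(γ_H)` is LOCALLY CONSTANT along the hyperbolic Levi shell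

Cell `pub/hodgecm-mathlib`, crux H413 = `stmt-HodgeConjecture-24833` (lane `--supports … --as helper`), route HCCMUnconditional; seat LH6-p03 (g0); desk F0P3b-plan (g23)
DEAL «WEYL-LC★» 05:44:41Z; road (D) owner LH6-p04 (g2), status v4 `F0/P3b/LH6-p04/g2/ROAD-D.status.v4.txt` § (c₅)(ii)+(iii).  THEOREMS ONLY, sorry-free, ★-only imports; no
definition ∕ instance ∕ notation ∕ named fact.  HONEST LABEL: HC_CM is proved only modulo the 7 printed citations (2 remaining: hLiu418 = stmt-HodgeConjecture-24832, h413 =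
stmt-HodgeConjecture-24833) until rung 0 closes; count-neutral plumbing of road (D) (constancy of the scalar `τ·D` on the support of `hlevi` of ★ `isLocalDeltaTransfer_of_levi`).

THE MATHEMATICS ([Rogawski1990, §4.9 p. 55]: `D_{G/H,v}(γ_H) = |Π_{α ∉ H}(1 − α(γ))|^{1/2} = (Π_{w′∣v} ‖χ_g(u)_{w′}‖)^{1/2}`, ★ `finWeylRatio`).  On the diagonal Levi
`γ_H = (diag(d′₀, d′₁), u)` one has `χ_g(u) = (u − d′₀)(u − d′₁)` (★ `eval_finCharpolyTwo_eq_of_endoEmbLocal_eq`), so `D = (Π‖u − d′₀‖)^{1/2}·(Π‖u − d′₁‖)^{1/2}`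
(§1).  On the HYPERBOLIC shell `‖d′₁‖_{w′} < ‖u‖_{w′} < ‖d′₀‖_{w′}` the ultrametric inequality gives `‖u − d′₀‖_{w′} = ‖d′₀‖_{w′}` and `‖u − d′₁‖_{w′} = ‖u‖_{w′}` (§2), hence
`D_{G/H,v}(γ_H) = (Π‖d′₀‖)^{1/2}·(Π‖u‖)^{1/2}` depends only on the absolute values of the entries (§3 HEAD `finWeylRatio_eq_of_hyperbolic`): it is CONSTANT along
every shell on which these absolute values are constant — in particular along `b·(T ∩ K_n)` for any `n ≥ 0`, multiplication by units of absolute value `1` not changing them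
(`finWeylRatio_eq_finWeylRatio_of_hyperbolic_of_norm_eq`, `finWeylRatio_eq_finWeylRatio_of_hyperbolic_of_mul_units`).

RECORDED, NOT TYPED HERE ((c₅)(iii) «level compatibility `Ψ(T_H ∩ K_H) = T₃ ∩ K_n`» and the `w`-flip agreement `W_H(T) = W_G(T) = ℤ/2`): the level groups `𝓘.K n` of ★
`exists_cmIwahoriDatum` (F0P3CMBorelIwahoriDatum) are ABSTRACT data of an existentially produced `IwahoriDatum` — the exported statement characterises `K₀` through the model but
not `𝓘.K n ∩ T` — so a set identity between the level groups of two independent such data (for `U(Φ₃)` and for `U(Φ₂) × U(Φ₁)`) is not derivable from the tree as it stands; it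
needs either a concrete `cmIwahoriDatum` exposing `K n = comap e (model level-n group)` or one more exported conjunct `∀ n, ∀ t ∈ T, (t ∈ 𝓘.K n ↔ ∀ i, ‖(t_i − 1)_{w}‖ ≤ q^{-n})`
on both sides.  For the scalar identity of (c₅) this file's valuation currency suffices: the support condition enters `hlevi` only through the absolute values of `d′₀, d′₁, u`.

## References
* [Rogawski1990] J. D. Rogawski, *Automorphic Representations of Unitary Groups in Three Variables*, Ann. of Math. Stud. 123 (1990): §4.9 p. 55 (`D_{G/H}`, `Δ_{G/H} = τ·D` on
  the Levi); §4.8 Case (a) p. 53; §12.7 L. 12.7.3 (proof) p. 195.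
* [NeukirchANT1999] J. Neukirch, *Algebraic Number Theory*, Springer GMW 322 (1999): Ch. II §6 (non-archimedean absolute values; the strong triangle inequality).
-/

set_option autoImplicit false
-- the mandated namespace has the single-problem summit's repeated segment (`HodgeConjecture.HodgeConjecture`)
set_option linter.dupNamespace false

noncomputable section

open Matrix NumberField IsDedekindDomain Polynomial
open scoped MatrixGroups
open Literature.NumberTheory.Rogawski1990 Literature.NumberTheory.Automorphic Literature.NumberTheory.Automorphic.UnitaryGroup

namespace Summit.HodgeConjecture.HodgeConjecture.Cruxes.H413.F0P3cStCharTSWeylRatioShell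

variable (L : Type) [Field L] [NumberField L] [IsCMField L] (v : HeightOneSpectrum (𝓞 ↥(maximalRealSubfield L)))

/-! ## §1 `D_{G/H,v}` on the diagonal Levi -/

/-- **`D_{G/H,v}(γ_H) = (Π_{w′}‖(u − d′₀)_{w′}‖)^{1/2} · (Π_{w′}‖(u − d′₁)_{w′}‖)^{1/2}`** for `γ_H = (diag(d′₀, d′₁), u)` on the diagonal Levi of `H_v = U(Φ₂) × U(Φ₁)`
(`χ_g(u) = (u − d′₀)(u − d′₁)`, ★ `eval_finCharpolyTwo_eq_of_endoEmbLocal_eq`, ★ `sqrt_prod_norm_mul`). [cite: Rogawski1990, §4.9 p. 55] -/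
theorem finWeylRatio_eq_sqrt_mul_sqrt_of_fst_eq
    (γH : (cmDatum L 2 (Matrix.of fun i j : Fin 2 => if i.val + j.val + 1 = 2 then (1 : L) else 0)).Local v ×
    (cmDatum L 1 (Matrix.of fun i j : Fin 1 => if i.val + j.val + 1 = 1 then (1 : L) else 0)).Local v)
    {d' : Fin 2 → (LocalRing L v)ˣ} (hd' : glDiagonal 2 (LocalRing L v) d' = (γH.1.val : GL (Fin 2) (LocalRing L v))) :
    finWeylRatio L v γH =
      Real.sqrt (∏ w' : PlacesOver L v, ‖(finGammaTwo L v γH - d' 0) w'‖) * Real.sqrt (∏ w' : PlacesOver L v, ‖(finGammaTwo L v γH - d' 1) w'‖) := by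
  have hχ := eval_finCharpolyTwo_eq_of_endoEmbLocal_eq L v γH (endoEmbLocal_eq_glDiagonal_of_fst_eq L v γH hd')
  simp only [Matrix.cons_val_zero, Matrix.cons_val_one, Matrix.cons_val_two, Matrix.tail_cons, Matrix.head_cons, IsUnit.unit_spec] at hχ
  unfold finWeylRatio
  rw [hχ, sqrt_prod_norm_mul]

/-! ## §2 The strong triangle inequality at the places `w′ ∣ v` -/

omit [IsCMField L] in
/-- `‖x‖_{w′} < ‖y‖_{w′} ⟹ ‖y − x‖_{w′} = ‖y‖_{w′}` in the non-archimedean completion `L_{w′}`. [cite: NeukirchANT1999, Ch. II §6] -/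
theorem norm_sub_eq_norm_left_of_norm_lt (w' : PlacesOver L v) {x y : w'.1.adicCompletion L} (h : ‖x‖ < ‖y‖) : ‖y - x‖ = ‖y‖ := by
  rw [sub_eq_add_neg, IsUltrametricDist.norm_add_eq_max_of_norm_ne_norm (by rw [norm_neg]; exact ne_of_gt h), norm_neg, max_eq_left h.le]

omit [IsCMField L] in
/-- `‖y‖_{w′} < ‖x‖_{w′} ⟹ ‖y − x‖_{w′} = ‖x‖_{w′}` in the non-archimedean completion `L_{w′}`. [cite: NeukirchANT1999, Ch. II §6] -/
theorem norm_sub_eq_norm_right_of_norm_lt (w' : PlacesOver L v) {x y : w'.1.adicCompletion L} (h : ‖y‖ < ‖x‖) : ‖y - x‖ = ‖x‖ := by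
  rw [← norm_neg, neg_sub, norm_sub_eq_norm_left_of_norm_lt L v w' h]

/-! ## §3 HEAD — local constancy of `D_{G/H,v}` along the hyperbolic shell -/

/-- **`D_{G/H,v}(γ_H) = (Π_{w′}‖d′₀‖_{w′})^{1/2} · (Π_{w′}‖u‖_{w′})^{1/2}` on the hyperbolic Levi shell** `‖d′₁‖_{w′} < ‖u‖_{w′} < ‖d′₀‖_{w′}` (all `w′ ∣ v`) of
`γ_H = (diag(d′₀, d′₁), u)`: there `‖u − d′₀‖ = ‖d′₀‖` and `‖u − d′₁‖ = ‖u‖` by the strong triangle inequality — so `D_{G/H,v}` depends only on the absolute values of the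
entries. [cite: Rogawski1990, §4.9 p. 55] [cite: NeukirchANT1999, Ch. II §6] -/
theorem finWeylRatio_eq_of_hyperbolic
    (γH : (cmDatum L 2 (Matrix.of fun i j : Fin 2 => if i.val + j.val + 1 = 2 then (1 : L) else 0)).Local v ×
    (cmDatum L 1 (Matrix.of fun i j : Fin 1 => if i.val + j.val + 1 = 1 then (1 : L) else 0)).Local v)
    {d' : Fin 2 → (LocalRing L v)ˣ} (hd' : glDiagonal 2 (LocalRing L v) d' = (γH.1.val : GL (Fin 2) (LocalRing L v)))
    (h₀ : ∀ w' : PlacesOver L v, ‖finGammaTwo L v γH w'‖ < ‖(d' 0 : LocalRing L v) w'‖)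
    (h₁ : ∀ w' : PlacesOver L v, ‖(d' 1 : LocalRing L v) w'‖ < ‖finGammaTwo L v γH w'‖) :
    finWeylRatio L v γH = Real.sqrt (∏ w' : PlacesOver L v, ‖(d' 0 : LocalRing L v) w'‖) * Real.sqrt (∏ w' : PlacesOver L v, ‖finGammaTwo L v γH w'‖) := by
  rw [finWeylRatio_eq_sqrt_mul_sqrt_of_fst_eq L v γH hd']
  congr 1
  · congr 1
    exact Finset.prod_congr rfl fun w' _ => by rw [Pi.sub_apply, norm_sub_eq_norm_right_of_norm_lt L v w' (h₀ w')]
  · congr 1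
    exact Finset.prod_congr rfl fun w' _ => by rw [Pi.sub_apply, norm_sub_eq_norm_left_of_norm_lt L v w' (h₁ w')]

/-- **Local constancy (c₅)(ii)**: two elements `γ_H = (diag(d′₀, d′₁), u)`, `γ′_H = (diag(e′₀, e′₁), u′)` of the hyperbolic Levi shell with the same absolute values
`‖d′₀‖_{w′} = ‖e′₀‖_{w′}`, `‖u‖_{w′} = ‖u′‖_{w′}` at every `w′ ∣ v` have the same `D_{G/H,v}` — `D_{G/H,v}` is constant along every shell `b·(T ∩ K_n)`, `n ≥ 0`.
[cite: Rogawski1990, §4.9 p. 55] -/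
theorem finWeylRatio_eq_finWeylRatio_of_hyperbolic_of_norm_eq
    (γH : (cmDatum L 2 (Matrix.of fun i j : Fin 2 => if i.val + j.val + 1 = 2 then (1 : L) else 0)).Local v ×
    (cmDatum L 1 (Matrix.of fun i j : Fin 1 => if i.val + j.val + 1 = 1 then (1 : L) else 0)).Local v)
    (γH' : (cmDatum L 2 (Matrix.of fun i j : Fin 2 => if i.val + j.val + 1 = 2 then (1 : L) else 0)).Local v ×
    (cmDatum L 1 (Matrix.of fun i j : Fin 1 => if i.val + j.val + 1 = 1 then (1 : L) else 0)).Local v)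
    {d' e' : Fin 2 → (LocalRing L v)ˣ} (hd' : glDiagonal 2 (LocalRing L v) d' = (γH.1.val : GL (Fin 2) (LocalRing L v)))
    (he' : glDiagonal 2 (LocalRing L v) e' = (γH'.1.val : GL (Fin 2) (LocalRing L v)))
    (h₀ : ∀ w' : PlacesOver L v, ‖finGammaTwo L v γH w'‖ < ‖(d' 0 : LocalRing L v) w'‖)
    (h₁ : ∀ w' : PlacesOver L v, ‖(d' 1 : LocalRing L v) w'‖ < ‖finGammaTwo L v γH w'‖)
    (h₀' : ∀ w' : PlacesOver L v, ‖finGammaTwo L v γH' w'‖ < ‖(e' 0 : LocalRing L v) w'‖)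
    (h₁' : ∀ w' : PlacesOver L v, ‖(e' 1 : LocalRing L v) w'‖ < ‖finGammaTwo L v γH' w'‖)
    (hn₀ : ∀ w' : PlacesOver L v, ‖(d' 0 : LocalRing L v) w'‖ = ‖(e' 0 : LocalRing L v) w'‖)
    (hnu : ∀ w' : PlacesOver L v, ‖finGammaTwo L v γH w'‖ = ‖finGammaTwo L v γH' w'‖) :
    finWeylRatio L v γH = finWeylRatio L v γH' := by
  rw [finWeylRatio_eq_of_hyperbolic L v γH hd' h₀ h₁, finWeylRatio_eq_of_hyperbolic L v γH' he' h₀' h₁', Finset.prod_congr rfl fun w' _ => hn₀ w',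
    Finset.prod_congr rfl fun w' _ => hnu w']

/-- **Local constancy along `γ_H · k` for level units**: if `γ′_H = (diag(d′₀k₀, d′₁k₁), u·k_u)` with `‖k₀‖_{w′} = ‖k₁‖_{w′} = ‖k_u‖_{w′} = 1` (e.g. `k ∈ T ∩ K_n`, any
`n ≥ 0`) and `γ_H` is on the hyperbolic shell, then so is `γ′_H` and `D_{G/H,v}(γ′_H) = D_{G/H,v}(γ_H)`. [cite: Rogawski1990, §4.9 p. 55] -/
theorem finWeylRatio_eq_finWeylRatio_of_hyperbolic_of_mul_units
    (γH : (cmDatum L 2 (Matrix.of fun i j : Fin 2 => if i.val + j.val + 1 = 2 then (1 : L) else 0)).Local v ×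
    (cmDatum L 1 (Matrix.of fun i j : Fin 1 => if i.val + j.val + 1 = 1 then (1 : L) else 0)).Local v)
    (γH' : (cmDatum L 2 (Matrix.of fun i j : Fin 2 => if i.val + j.val + 1 = 2 then (1 : L) else 0)).Local v ×
    (cmDatum L 1 (Matrix.of fun i j : Fin 1 => if i.val + j.val + 1 = 1 then (1 : L) else 0)).Local v)
    {d' e' : Fin 2 → (LocalRing L v)ˣ} (hd' : glDiagonal 2 (LocalRing L v) d' = (γH.1.val : GL (Fin 2) (LocalRing L v)))
    (he' : glDiagonal 2 (LocalRing L v) e' = (γH'.1.val : GL (Fin 2) (LocalRing L v)))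
    (h₀ : ∀ w' : PlacesOver L v, ‖finGammaTwo L v γH w'‖ < ‖(d' 0 : LocalRing L v) w'‖)
    (h₁ : ∀ w' : PlacesOver L v, ‖(d' 1 : LocalRing L v) w'‖ < ‖finGammaTwo L v γH w'‖)
    (k : Fin 2 → LocalRing L v) (ku : LocalRing L v) (hk : ∀ i, ∀ w' : PlacesOver L v, ‖k i w'‖ = 1) (hku : ∀ w' : PlacesOver L v, ‖ku w'‖ = 1)
    (he₀ : (e' 0 : LocalRing L v) = d' 0 * k 0) (he₁ : (e' 1 : LocalRing L v) = d' 1 * k 1) (hu : finGammaTwo L v γH' = finGammaTwo L v γH * ku) :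
    finWeylRatio L v γH' = finWeylRatio L v γH := by
  have hn₀ : ∀ w' : PlacesOver L v, ‖(e' 0 : LocalRing L v) w'‖ = ‖(d' 0 : LocalRing L v) w'‖ := fun w' => by rw [he₀, Pi.mul_apply, norm_mul, hk 0 w', mul_one]
  have hn₁ : ∀ w' : PlacesOver L v, ‖(e' 1 : LocalRing L v) w'‖ = ‖(d' 1 : LocalRing L v) w'‖ := fun w' => by rw [he₁, Pi.mul_apply, norm_mul, hk 1 w', mul_one]
  have hnu : ∀ w' : PlacesOver L v, ‖finGammaTwo L v γH' w'‖ = ‖finGammaTwo L v γH w'‖ := fun w' => by rw [hu, Pi.mul_apply, norm_mul, hku w', mul_one]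
  exact finWeylRatio_eq_finWeylRatio_of_hyperbolic_of_norm_eq L v γH' γH he' hd' (fun w' => by rw [hnu, hn₀]; exact h₀ w')
    (fun w' => by rw [hn₁, hnu]; exact h₁ w') h₀ h₁ hn₀ hnu

end Summit.HodgeConjecture.HodgeConjecture.Cruxes.H413.F0P3cStCharTSWeylRatioShell

end
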